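import Summits.HodgeConjecture.CorCM.Census.HalfParityCount
import Summits.HodgeConjecture.CorCM.Census.TypeStabiliserIndexTwoRank

/-!
# `𝔛(G,c) = Hom(G/𝒦, 𝔽₂)`: b09ʼs stabiliser characters ARE the characters of `G/𝒦`, so `dim 𝔛 = d₂(G/𝒦)` and the
# closed form of the coinvariant fibre reads `φ₂(G,c) + 1 + [|G|/2 even] = β(G,c) + d₂(G/𝒦)`

COR-CM (cell `pub-hodgecm2`), count-neutral kernel combinatorics by the census seat lit-andre-3 (gen 20; lane TYPE-STABILISER-SUBGROUP,
THE GLUE), sequel of `Census/TypeStabiliserIndexTwoRank.lean` (`indexTwoRank`, `finrank_addChar_quotient`, §6 over `𝒦 = stabGen c`) and of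
b09ʼs `Census/HalfParityCount.lean` (XIII: `charK`, ANDRÉ-3ʼS LAW IN CLOSED FORM `φ₂ + 1 + [|G|/2 even] = β + dim_𝔽₂ 𝔛`).  Three
bookkeeping definitions with bodies (`addHom`, `charKLift`, `charKEquiv` — an explicit bijection, no choice) + theorems, everything proved;
no `Prop`-valued definition, no certificate, no named fact, no `sorry`.  HONEST FRAMING: `HC_CM` is NOT proved; nothing here is a period
or a headline.

THE IDENTIFICATION.  b09ʼs `𝔛(G,c) = charK c` is the `𝔽₂`-space of additive `χ : G → 𝔽₂` with `χ(c) = 0` killing the stabiliser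
`stab Ψ` of every CM type `Ψ`.  By the universal property of the type-stabiliser subgroup (`stabGen_le_iff`:
`𝒦 ≤ H ↔ c ∈ H ∧ ∀ Ψ, stab Ψ ≤ H`, gen 19) this says exactly `𝒦 ≤ ker χ` (`mem_charK_iff_stabGen_le`), i.e. `χ` factors through
`G ⧸ 𝒦`: **`charKEquiv : 𝔛(G,c) ≃ Hom(G ⧸ 𝒦, ℤ/2)`** (§2; `charKLinearEquiv`, the same as an `𝔽₂`-linear isomorphism onto the additive
characters of `G ⧸ 𝒦`).  Hence (§3) **`#𝔛 = 2 ^ d₂(G/𝒦) = #{H : [G:H] = 2, 𝒦 ≤ H} + 1`** (`natCard_charK`,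
`natCard_charK_eq_card_indexTwoOver_add_one`) and **`dim_𝔽₂ 𝔛(G,c) = d₂(G/𝒦) = indexTwoRank (stabGen c)`** (`finrank_charK_eq_indexTwoRank`).

THE CLOSED FORM IN THE `d₂` CURRENCY (§4, rewriting b09ʼs `fibreTwo_add_eq_card_block_add_finrank_charK`):
**`φ₂(G,c) + 1 + [|G|/2 even] = β(G,c) + d₂(G/𝒦)`** (`fibreTwo_add_eq_card_block_add_indexTwoRank`), with the even/odd forms, the
choice-free count form **`2 ^ (φ₂ + 1 + [|G|/2 even]) = 2 ^ β · (#{H : [G:H] = 2, 𝒦 ≤ H} + 1)`** (`two_pow_fibreTwo_add_eq`), and the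
MINIMALITY CRITERION **`φ₂ + 1 + [|G|/2 even] = β ↔` no index-two `H ∋ c` contains every stabiliser** (`fibreTwo_add_eq_card_block_iff`;
e.g. every complemented `c`, `fibreTwo_add_eq_card_block_of_cpl` — b09ʼs DIRECT-FACTOR theorem and `𝒦`-criterion recovered as the case
`d₂ = 0`).  In field language (for the record, not formalised here): for a Galois CM field `F` with group `G` and complex conjugation `c`,
`2 ^ d₂(G/𝒦) − 1` is the number of (necessarily real) quadratic subfields of `F` fixed by the stabiliser of every CM type of `F`.

## References
* [Pohlmann1968] H. Pohlmann, Algebraic cycles on abelian varieties of complex multiplication type, Ann. of Math. 88 (1968), Thm 1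
  (the Hodge ring of a CM abelian variety of Galois CM type as the `G`-coinvariant lattice; the objects `φ₂`, `β` are its bookkeeping).
-/

namespace Summit.HodgeConjecture.CorCM.Census.TypeStabiliser

open Summit.HodgeConjecture.CorCM.Prior.AllgGroup.RfwfAllgGroup
open Summit.HodgeConjecture.CorCM.Census.BlockParity
open Summit.HodgeConjecture.CorCM.Census.Coinvariant
open Summit.HodgeConjecture.CorCM.Census.HalfParity
open Summit.HodgeConjecture.CorCM.Census.IndexTwo

noncomputable section

variable {G : Type*} [Group G] [Fintype G] [DecidableEq G] (c : G)

/-! ## §1 Membership in `𝔛` through `𝒦` -/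

omit [Fintype G] [DecidableEq G] in
/-- An additive map `χ : G → 𝔽₂` kills `1`. [folklore] -/
theorem apply_one_eq_zero_of_add (χ : G → ZMod 2) (hadd : ∀ a b : G, χ (a * b) = χ a + χ b) : χ 1 = 0 :=
  (mem_addKer χ hadd 1).mp (addKer χ hadd).one_mem

omit [Fintype G] [DecidableEq G] in
/-- An additive map `χ : G → 𝔽₂` satisfies `χ(g⁻¹) = χ(g)`. [folklore] -/
theorem apply_inv_eq_of_add (χ : G → ZMod 2) (hadd : ∀ a b : G, χ (a * b) = χ a + χ b) (g : G) : χ g⁻¹ = χ g := by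
  have h := hadd g g⁻¹
  rw [mul_inv_cancel, apply_one_eq_zero_of_add χ hadd] at h
  have key : ∀ x y : ZMod 2, 0 = x + y → y = x := by decide
  exact key _ _ h

/-- **`χ ∈ 𝔛(G,c) ↔ χ` is additive and `𝒦 ≤ ker χ`** (`c` a central involution): b09ʼs three membership conditions
(additive, `χ(c) = 0`, `χ` kills every `stab Ψ`) are «`χ` is a character of `G` trivial on `𝒦`», by `stabGen_le_iff`. [folklore] -/
theorem mem_charK_iff_stabGen_le (hc2 : c * c = 1) (hcen : ∀ x : G, x * c = c * x) (χ : G → ZMod 2) :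
    χ ∈ charK c ↔ ∃ hadd : ∀ a b : G, χ (a * b) = χ a + χ b, stabGen c ≤ addKer χ hadd := by
  rw [mem_charK]
  constructor
  · rintro ⟨hadd, hc0, hst⟩
    refine ⟨hadd, (stabGen_le_iff c hc2 hcen).mpr ⟨(mem_addKer χ hadd c).mpr hc0, fun Ψ Q hQ => ?_⟩⟩
    exact (mem_addKer χ hadd Q).mpr (hst Ψ Q ((mem_stab c Ψ Q).mp hQ))
  · rintro ⟨hadd, hle⟩
    obtain ⟨hc0, hst⟩ := (stabGen_le_iff c hc2 hcen).mp hle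
    exact ⟨hadd, (mem_addKer χ hadd c).mp hc0, fun Ψ Q hQ => (mem_addKer χ hadd Q).mp (hst Ψ ((mem_stab c Ψ Q).mpr hQ))⟩

/-- A stabiliser character kills `𝒦`. [folklore] -/
theorem apply_eq_zero_of_mem_charK (hc2 : c * c = 1) (hcen : ∀ x : G, x * c = c * x) {χ : G → ZMod 2} (hχ : χ ∈ charK c)
    {g : G} (hg : g ∈ stabGen c) : χ g = 0 := by
  obtain ⟨hadd, hle⟩ := (mem_charK_iff_stabGen_le c hc2 hcen χ).mp hχ
  exact (mem_addKer χ hadd g).mp (hle hg)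

/-- Conversely an additive `χ` killing `𝒦` is a stabiliser character. [folklore] -/
theorem mem_charK_of_forall (hc2 : c * c = 1) (hcen : ∀ x : G, x * c = c * x) {χ : G → ZMod 2}
    (hadd : ∀ a b : G, χ (a * b) = χ a + χ b) (h : ∀ g ∈ stabGen c, χ g = 0) : χ ∈ charK c :=
  (mem_charK_iff_stabGen_le c hc2 hcen χ).mpr ⟨hadd, fun g hg => (mem_addKer χ hadd g).mpr (h g hg)⟩

/-- A stabiliser character is constant on `𝒦`-cosets: `χ(g k) = χ(g)` for `k ∈ 𝒦`. [folklore] -/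
theorem apply_mul_eq_of_mem_charK (hc2 : c * c = 1) (hcen : ∀ x : G, x * c = c * x) {χ : G → ZMod 2} (hχ : χ ∈ charK c)
    (g : G) {k : G} (hk : k ∈ stabGen c) : χ (g * k) = χ g := by
  rw [((mem_charK c χ).mp hχ).1, apply_eq_zero_of_mem_charK c hc2 hcen hχ hk, add_zero]

/-! ## §2 The bijection `𝔛(G,c) ≃ Hom(G ⧸ 𝒦, ℤ/2)` -/

omit [Fintype G] [DecidableEq G] in
/-- An additive map `χ : G → 𝔽₂` as a monoid homomorphism `G →* Multiplicative (ℤ/2)`. [folklore] -/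
def addHom (χ : G → ZMod 2) (hadd : ∀ a b : G, χ (a * b) = χ a + χ b) : G →* Multiplicative (ZMod 2) where
  toFun g := Multiplicative.ofAdd (χ g)
  map_one' := by rw [apply_one_eq_zero_of_add χ hadd, ofAdd_zero]
  map_mul' a b := by rw [hadd, ofAdd_add]

omit [Fintype G] [DecidableEq G] in
/-- Evaluation of `addHom`. [folklore] -/
@[simp] theorem addHom_apply (χ : G → ZMod 2) (hadd : ∀ a b : G, χ (a * b) = χ a + χ b) (g : G) :
    addHom χ hadd g = Multiplicative.ofAdd (χ g) := rfl

omit [Fintype G] [DecidableEq G] in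
/-- The kernel of `addHom χ` is `addKer χ`. [folklore] -/
theorem ker_addHom (χ : G → ZMod 2) (hadd : ∀ a b : G, χ (a * b) = χ a + χ b) : (addHom χ hadd).ker = addKer χ hadd := by
  ext g
  rw [MonoidHom.mem_ker, addHom_apply, mem_addKer, ← ofAdd_zero, Multiplicative.ofAdd.injective.eq_iff]

/-- **The character of `G ⧸ 𝒦` defined by a stabiliser character** (`QuotientGroup.lift`). [folklore] -/
def charKLift [(stabGen c).Normal] (hc2 : c * c = 1) (hcen : ∀ x : G, x * c = c * x) (χ : ↥(charK c)) :
    G ⧸ stabGen c →* Multiplicative (ZMod 2) :=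
  QuotientGroup.lift (stabGen c) (addHom χ.1 ((mem_charK c χ.1).mp χ.2).1) (by
    rw [ker_addHom]
    exact ((mem_charK_iff_stabGen_le c hc2 hcen χ.1).mp χ.2).2)

/-- `charKLift χ [g] = χ(g)`. [folklore] -/
@[simp] theorem charKLift_mk [(stabGen c).Normal] (hc2 : c * c = 1) (hcen : ∀ x : G, x * c = c * x) (χ : ↥(charK c)) (g : G) :
    charKLift c hc2 hcen χ (g : G ⧸ stabGen c) = Multiplicative.ofAdd (χ.1 g) := by
  rw [charKLift, QuotientGroup.lift_mk, addHom_apply]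

/-- The function `g ↦ φ([g])` of a character `φ` of `G ⧸ 𝒦` is a stabiliser character. [folklore] -/
theorem comp_mk_mem_charK [(stabGen c).Normal] (hc2 : c * c = 1) (hcen : ∀ x : G, x * c = c * x)
    (φ : G ⧸ stabGen c →* Multiplicative (ZMod 2)) :
    (fun g : G => Multiplicative.toAdd (φ (g : G ⧸ stabGen c))) ∈ charK c := by
  refine mem_charK_of_forall c hc2 hcen (fun a b => ?_) (fun g hg => ?_)
  · simp only [QuotientGroup.mk_mul, map_mul, toAdd_mul]
  · simp only [(QuotientGroup.eq_one_iff g).mpr hg, map_one, toAdd_one]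

/-- **`𝔛(G,c) ≃ Hom(G ⧸ 𝒦, ℤ/2)`**: stabiliser characters are exactly the `ℤ/2`-valued characters of `G ⧸ 𝒦` (an explicit
bijection: lift, and compose with the projection). [folklore] -/
def charKEquiv [(stabGen c).Normal] (hc2 : c * c = 1) (hcen : ∀ x : G, x * c = c * x) :
    ↥(charK c) ≃ (G ⧸ stabGen c →* Multiplicative (ZMod 2)) where
  toFun := charKLift c hc2 hcen
  invFun φ := ⟨fun g : G => Multiplicative.toAdd (φ (g : G ⧸ stabGen c)), comp_mk_mem_charK c hc2 hcen φ⟩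
  left_inv χ := by
    ext g
    simp only [charKLift_mk, toAdd_ofAdd]
  right_inv φ := by
    refine MonoidHom.ext fun x => ?_
    induction x using QuotientGroup.induction_on with
    | H g => rw [charKLift_mk, ofAdd_toAdd]

/-- Evaluation of `charKEquiv`. [folklore] -/
@[simp] theorem charKEquiv_apply_mk [(stabGen c).Normal] (hc2 : c * c = 1) (hcen : ∀ x : G, x * c = c * x)
    (χ : ↥(charK c)) (g : G) : charKEquiv c hc2 hcen χ (g : G ⧸ stabGen c) = Multiplicative.ofAdd (χ.1 g) :=
  charKLift_mk c hc2 hcen χ g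

/-- Evaluation of `charKEquiv.symm`. [folklore] -/
@[simp] theorem charKEquiv_symm_apply [(stabGen c).Normal] (hc2 : c * c = 1) (hcen : ∀ x : G, x * c = c * x)
    (φ : G ⧸ stabGen c →* Multiplicative (ZMod 2)) (g : G) :
    ((charKEquiv c hc2 hcen).symm φ).1 g = Multiplicative.toAdd (φ (g : G ⧸ stabGen c)) := rfl

/-- **`𝔛(G,c) ≃ₗ Hom(G ⧸ 𝒦, 𝔽₂)` as `𝔽₂`-vector spaces** (the same bijection, read into the additive characters of `G ⧸ 𝒦`;
additivity is pointwise). [folklore] -/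
def charKLinearEquiv [(stabGen c).Normal] (hc2 : c * c = 1) (hcen : ∀ x : G, x * c = c * x) :
    ↥(charK c) ≃ₗ[ZMod 2] (Additive (G ⧸ stabGen c) →+ ZMod 2) :=
  { (charKEquiv c hc2 hcen).trans MonoidHom.toAdditiveLeft with
    map_add' := fun χ₁ χ₂ => by
      refine AddMonoidHom.ext fun x => ?_
      obtain ⟨y, rfl⟩ := Additive.ofMul.surjective x
      induction y using QuotientGroup.induction_on with
      | H g =>
        simp only [Equiv.toFun_as_coe, Equiv.trans_apply, MonoidHom.coe_toAdditiveLeft, Function.comp_apply, toMul_ofMul,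
          charKEquiv_apply_mk, toAdd_ofAdd, AddMonoidHom.add_apply, Submodule.coe_add, Pi.add_apply]
    map_smul' := fun r χ => by
      refine AddMonoidHom.ext fun x => ?_
      obtain ⟨y, rfl⟩ := Additive.ofMul.surjective x
      induction y using QuotientGroup.induction_on with
      | H g =>
        simp only [Equiv.toFun_as_coe, Equiv.trans_apply, MonoidHom.coe_toAdditiveLeft, Function.comp_apply, toMul_ofMul,
          charKEquiv_apply_mk, toAdd_ofAdd, RingHom.id_apply, AddMonoidHom.smul_apply, Submodule.coe_smul, Pi.smul_apply] }

/-- Evaluation of `charKLinearEquiv`. [folklore] -/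
@[simp] theorem charKLinearEquiv_apply [(stabGen c).Normal] (hc2 : c * c = 1) (hcen : ∀ x : G, x * c = c * x)
    (χ : ↥(charK c)) (g : G) : charKLinearEquiv c hc2 hcen χ (Additive.ofMul (g : G ⧸ stabGen c)) = χ.1 g := by
  change MonoidHom.toAdditiveLeft (charKEquiv c hc2 hcen χ) (Additive.ofMul (g : G ⧸ stabGen c)) = χ.1 g
  rw [MonoidHom.coe_toAdditiveLeft, Function.comp_apply, Function.comp_apply, toMul_ofMul, charKEquiv_apply_mk, toAdd_ofAdd]

/-! ## §3 The count: `#𝔛 = 2 ^ d₂(G/𝒦)` and `dim 𝔛 = d₂(G/𝒦)` -/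

/-- **`#𝔛(G,c) = 2 ^ d₂(G/𝒦)`.** [folklore] -/
theorem natCard_charK (hc2 : c * c = 1) (hcen : ∀ x : G, x * c = c * x) :
    Nat.card ↥(charK c) = 2 ^ indexTwoRank (stabGen c) := by
  haveI := stabGen_normal c hcen
  rw [Nat.card_congr (charKEquiv c hc2 hcen), card_signChar_quotient]

/-- **`#𝔛(G,c) = #{H : [G:H] = 2, 𝒦 ≤ H} + 1`** — the choice-free count: a non-zero stabiliser character is the sign character of
a unique index-two subgroup over `𝒦`. [folklore] -/
theorem natCard_charK_eq_card_indexTwoOver_add_one (hc2 : c * c = 1) (hcen : ∀ x : G, x * c = c * x) :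
    Nat.card ↥(charK c) = Nat.card {H : Subgroup G // H.index = 2 ∧ stabGen c ≤ H} + 1 := by
  rw [natCard_charK c hc2 hcen, two_pow_indexTwoRank_stabGen c hcen]

/-- **THE GLUE: `dim_𝔽₂ 𝔛(G,c) = d₂(G/𝒦)`** — b09ʼs `Module.finrank (ZMod 2) ↥(charK c)` is lit-andre-3ʼs `indexTwoRank (stabGen c)`.
[folklore] -/
theorem finrank_charK_eq_indexTwoRank (hc2 : c * c = 1) (hcen : ∀ x : G, x * c = c * x) :
    Module.finrank (ZMod 2) ↥(charK c) = indexTwoRank (stabGen c) := by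
  haveI := stabGen_normal c hcen
  rw [(charKLinearEquiv c hc2 hcen).finrank_eq, finrank_addChar_quotient]

/-- `dim 𝔛 = 0 ↔` no index-two subgroup lies over `𝒦` (`↔` no index-two `H ∋ c` contains every stabiliser). [folklore] -/
theorem finrank_charK_eq_zero_iff (hc2 : c * c = 1) (hcen : ∀ x : G, x * c = c * x) :
    Module.finrank (ZMod 2) ↥(charK c) = 0 ↔ ∀ H : Subgroup G, H.index = 2 → c ∈ H → ∃ Ψ : CMF G c, ¬ stab c Ψ ≤ H := by
  rw [finrank_charK_eq_indexTwoRank c hc2 hcen]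
  constructor
  · intro h0 H hH hc
    by_contra hne
    refine indexTwoRank_stabGen_ne_zero c hc2 hcen hH hc (fun Ψ => ?_) h0
    by_contra hΨ
    exact hne ⟨Ψ, hΨ⟩
  · exact indexTwoRank_stabGen_eq_zero_of_forall c hc2 hcen

/-! ## §4 The closed form of the coinvariant fibre in the `d₂` currency -/

/-- **ANDRÉ-3ʼS LAW IN CLOSED FORM, `d₂` currency: `φ₂(G,c) + 1 + [|G|/2 even] = β(G,c) + d₂(G/𝒦)`** (b09ʼs
`fibreTwo_add_eq_card_block_add_finrank_charK` with `dim 𝔛 = d₂(G/𝒦)`). [folklore] -/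
theorem fibreTwo_add_eq_card_block_add_indexTwoRank (hc2 : c * c = 1) (hc1 : c ≠ 1) (hcen : ∀ x : G, x * c = c * x) :
    fibreTwo c hc2 + 1 + (if Even (Fintype.card G / 2) then 1 else 0) =
      Fintype.card (Block c) + indexTwoRank (stabGen c) := by
  rw [← finrank_charK_eq_indexTwoRank c hc2 hcen]
  exact fibreTwo_add_eq_card_block_add_finrank_charK c hc2 hc1 hcen

/-- `|G|/2` even: **`φ₂ + 2 = β + d₂(G/𝒦)`**. [folklore] -/
theorem fibreTwo_add_two_eq_card_block_add_indexTwoRank (hc2 : c * c = 1) (hc1 : c ≠ 1) (hcen : ∀ x : G, x * c = c * x)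
    (heven : Even (Fintype.card G / 2)) :
    fibreTwo c hc2 + 2 = Fintype.card (Block c) + indexTwoRank (stabGen c) := by
  rw [← finrank_charK_eq_indexTwoRank c hc2 hcen]
  exact fibreTwo_add_two_eq_of_even c hc2 hc1 hcen heven

/-- `|G|/2` odd: **`φ₂ + 1 = β + d₂(G/𝒦)`**. [folklore] -/
theorem fibreTwo_add_one_eq_card_block_add_indexTwoRank (hc2 : c * c = 1) (hc1 : c ≠ 1) (hcen : ∀ x : G, x * c = c * x)
    (hodd : Odd (Fintype.card G / 2)) :
    fibreTwo c hc2 + 1 = Fintype.card (Block c) + indexTwoRank (stabGen c) := by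
  rw [← finrank_charK_eq_indexTwoRank c hc2 hcen]
  exact fibreTwo_add_one_eq_of_odd c hc2 hc1 hcen hodd

/-- **The count form, no logarithm and no dimension: `2 ^ (φ₂ + 1 + [|G|/2 even]) = 2 ^ β · (#{H : [G:H] = 2, 𝒦 ≤ H} + 1)`.**
[folklore] -/
theorem two_pow_fibreTwo_add_eq (hc2 : c * c = 1) (hc1 : c ≠ 1) (hcen : ∀ x : G, x * c = c * x) :
    2 ^ (fibreTwo c hc2 + 1 + (if Even (Fintype.card G / 2) then 1 else 0)) =
      2 ^ Fintype.card (Block c) * (Nat.card {H : Subgroup G // H.index = 2 ∧ stabGen c ≤ H} + 1) := by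
  rw [fibreTwo_add_eq_card_block_add_indexTwoRank c hc2 hc1 hcen, pow_add, two_pow_indexTwoRank_stabGen c hcen]

/-- **MINIMALITY CRITERION: `φ₂ + 1 + [|G|/2 even] = β ↔` no index-two `H ∋ c` contains the stabiliser of every type** (`d₂ = 0`;
b09ʼs `𝒦`-criterion of `HalfParityStabiliser` is the direction `←`, now an equivalence). [folklore] -/
theorem fibreTwo_add_eq_card_block_iff (hc2 : c * c = 1) (hc1 : c ≠ 1) (hcen : ∀ x : G, x * c = c * x) :
    fibreTwo c hc2 + 1 + (if Even (Fintype.card G / 2) then 1 else 0) = Fintype.card (Block c) ↔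
      ∀ H : Subgroup G, H.index = 2 → c ∈ H → ∃ Ψ : CMF G c, ¬ stab c Ψ ≤ H := by
  rw [← finrank_charK_eq_zero_iff c hc2 hcen, finrank_charK_eq_indexTwoRank c hc2 hcen,
    fibreTwo_add_eq_card_block_add_indexTwoRank c hc2 hc1 hcen]
  omega

/-- The complemented case (`G = A × ⟨c⟩`): **`φ₂ + 1 + [|G|/2 even] = β`** (`𝒦 = G`, `d₂ = 0`; b09ʼs DIRECT-FACTOR coinvariant theorem,
recovered from the closed form). [folklore] -/
theorem fibreTwo_add_eq_card_block_of_cpl (hc2 : c * c = 1) (hc1 : c ≠ 1) (hcen : ∀ x : G, x * c = c * x) {A : Subgroup G}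
    (hA : ∀ x : G, x ∈ A ↔ c * x ∉ A) :
    fibreTwo c hc2 + 1 + (if Even (Fintype.card G / 2) then 1 else 0) = Fintype.card (Block c) := by
  rw [fibreTwo_add_eq_card_block_add_indexTwoRank c hc2 hc1 hcen, indexTwoRank_stabGen_eq_zero_of_cpl c hc2 hA, add_zero]

/-- **UPPER BOUND `φ₂ + 1 + [|G|/2 even] ≤ β + d₂(G/⟨c⟩)`-style: `2 ^ (φ₂ + 1 + [|G|/2 even]) ≤ 2 ^ β · (#{H : [G:H] = 2, c ∈ H} + 1)`** —
at most b09ʼs `h(G,c)` index-two subgroups lie over `𝒦` (`card_indexTwoOver_stabGen_le`). [folklore] -/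
theorem two_pow_fibreTwo_add_le (hc2 : c * c = 1) (hc1 : c ≠ 1) (hcen : ∀ x : G, x * c = c * x) :
    2 ^ (fibreTwo c hc2 + 1 + (if Even (Fintype.card G / 2) then 1 else 0)) ≤
      2 ^ Fintype.card (Block c) * (Nat.card {H : Subgroup G // H.index = 2 ∧ c ∈ H} + 1) := by
  rw [two_pow_fibreTwo_add_eq c hc2 hc1 hcen]
  exact Nat.mul_le_mul_left _ (Nat.add_le_add_right (card_indexTwoOver_stabGen_le c) 1)

end

end Summit.HodgeConjecture.CorCM.Census.TypeStabiliser
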